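import Summits.AtomisticToContinuum.FouriersLaw.Theorems.OddSectorIrreversibilityOddDensityIsCorrectorResolventL2
import Mathlib.MeasureTheory.Group.Integral

/-!
# `HonestZwanzig.FeshbachIdentities`, part 5: the resolvent of the equilibrium kernels — Fubini and the shift identity

Support file for item `stmt-AtomisticToContinuum-12697` (`HonestZwanzig.FeshbachIdentities`), clause (iv-b)
(positivity of `G(s) = [lap_s(e_x, e_y)]`). Pinned anharmonic chain `P = pinnedChain ω₂ lam β γ` (`ω₂ > 0`,
`lam ≥ 0`, `β, γ > 0`), `N ≥ 1`, `T > 0`, `μ_T = gibbsMeasure N T`, `P_t = transitionKernel N T T t`, a NICE observable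
`v` (continuous, `|v| ≤ C e^{ϑH}`, `0 < ϑ`, `2ϑ < 1/T`), `s > 0`, and the RESOLVENT written out,
`R_s v(z) = ∫_{(0,∞)} e^{-st} P_t v(z) dt` (`…OddDensityIsCorrectorResolvent`):

* `pinnedChain_act_act_eq_nice` — the semigroup law on nice observables, `P_h (P_t v) = P_{h+t} v` pointwise
  (Chapman–Kolmogorov `pinnedChain_transitionKernel_add`);
* `pinnedChain_integral_mul_setIntegral_exp_act` — Fubini: `∫ F (∫_S e^{-st} P_t v dt) dν = ∫_S e^{-st} ⟨F, P_t v⟩_ν dt`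
  for a finite measure `ν` integrating `e^{2ϑH}`, `F ∈ L²(ν)` and `e^{-st} ∈ L¹(S)`;
* `pinnedChain_act_resolvent_eq` — **the shift identity** `P_h (R_s v)(z) = e^{sh} (R_s v(z) - ∫₀ʰ e^{-st} P_t v(z) dt)`
  (`h ≥ 0`), i.e. `R_s v - e^{-sh} P_h R_s v = ∫₀ʰ e^{-st} P_t v dt` — the resolvent equation without generators.

Part 6 (`…ResolventB`) turns the shift identity into `⟨v, R_s v⟩_{μ_T} ≥ s ‖R_s v‖²_{L²(μ_T)}` and the injectivity
of `R_s` on nice observables.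
-/

noncomputable section

open MeasureTheory ProbabilityTheory Filter Topology Set Function
open scoped NNReal ENNReal
open Literature.MathematicalPhysics.KineticTheory.HeatConduction
open Literature.MathematicalPhysics.KineticTheory OscillatorChain
open Summit.AtomisticToContinuum.FouriersLaw.Theorems.SubdiffusiveBondHeat
open Summit.AtomisticToContinuum.FouriersLaw.Theorems.OddSectorIrreversibility

namespace Summit.AtomisticToContinuum.FouriersLaw.Theorems.HonestZwanzig

variable {N : ℕ}

/-! ### Half-line bookkeeping -/

/-- Translation on the half-line: `∫_{(0,∞)} G(t + h) dt = ∫_{(h,∞)} G(t) dt`. [folklore] -/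
theorem setIntegral_Ioi_comp_add_right (G : ℝ → ℝ) (h : ℝ) :
    ∫ t in Ioi (0 : ℝ), G (t + h) = ∫ t in Ioi h, G t := by
  rw [← integral_indicator measurableSet_Ioi, ← integral_indicator measurableSet_Ioi]
  have e : (Ioi (0 : ℝ)).indicator (fun t => G (t + h)) = fun t => (Ioi h).indicator G (t + h) := by
    funext t
    simp only [Set.indicator_apply, mem_Ioi]
    have : (0 < t) ↔ (h < t + h) := by constructor <;> intro ht <;> linarith
    by_cases ht : 0 < t
    · rw [if_pos ht, if_pos (this.1 ht)]
    · rw [if_neg ht, if_neg (fun h' => ht (this.2 h'))]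
  rw [e]
  exact integral_add_right_eq_self (μ := (volume : Measure ℝ)) ((Ioi h).indicator G) h

section Pinned

variable {ω₂ lam β γ : ℝ} (hω : 0 < ω₂) (hl : 0 ≤ lam) (hβ : 0 < β) (hγ : 0 < γ) (hN : 0 < N)
  {T : ℝ} (hT : 0 < T)
include hω hl hβ hγ hN hT

/-! ### The semigroup law on nice observables -/

omit hβ hγ in
/-- **`P_h (P_t v) = P_{h+t} v`** pointwise, for a nice observable `v` (Chapman–Kolmogorov). [folklore] -/
theorem pinnedChain_act_act_eq_nice (hβ' : 0 ≤ β) (hγ' : 0 ≤ γ) {ϑ : ℝ} (hϑ0 : 0 < ϑ) (hϑ1 : ϑ < 1 / T)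
    {v : PhaseSpace N → ℝ} (hv : Continuous v) {Cv : ℝ}
    (hvb : ∀ y, |v y| ≤ Cv * Real.exp (ϑ * (pinnedChain ω₂ lam β γ).hamiltonian N y)) (t h : ℝ≥0) (z : PhaseSpace N) :
    ∫ y, (∫ w, v w ∂((pinnedChain ω₂ lam β γ).transitionKernel N T T t y))
        ∂((pinnedChain ω₂ lam β γ).transitionKernel N T T h z) =
      ∫ w, v w ∂((pinnedChain ω₂ lam β γ).transitionKernel N T T (h + t) z) := by
  rw [pinnedChain_transitionKernel_add hω hl hβ' hγ' N T T h t]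
  have hi : Integrable v (((pinnedChain ω₂ lam β γ).transitionKernel N T T t ∘ₖ
      (pinnedChain ω₂ lam β γ).transitionKernel N T T h) z) := by
    rw [← pinnedChain_transitionKernel_add hω hl hβ' hγ' N T T h t]
    exact pinnedChain_integrable_transitionKernel_of_abs_le hω hl hN hT hβ' hγ' hϑ0 hϑ1 hv hvb _ z
  exact (Kernel.integral_comp hi).symm

/-! ### Fubini for `∫ F (∫_S e^{-st} P_t v) dν` -/

omit hN hT in
/-- **Fubini**: let `ν` be a finite measure on phase space integrating `e^{2ϑH}`, `F` strongly measurable with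
`F² ∈ L¹(ν)`, `v` nice (`|v| ≤ C e^{ϑH}`, `0 < ϑ`), `S ⊆ ℝ` with `e^{-st} ∈ L¹(S)`. Then
`∫ F(z) (∫_S e^{-st} P_t v(z) dt) dν(z) = ∫_S e^{-st} (∫ F · P_t v dν) dt` (domination
`|F| |P_t v| ≤ |F| B e^{ϑH} ≤ B(F² + e^{2ϑH})/2`, `B` the `t`-uniform Harris bound). [folklore] -/
theorem pinnedChain_integral_mul_setIntegral_exp_act {ϑ : ℝ} (hϑ0 : 0 < ϑ)
    {K c : ℝ} (hb : ∀ (z : PhaseSpace N) (t : ℝ≥0) (f : PhaseSpace N → ℝ), Continuous f →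
      ∀ C : ℝ, 0 ≤ C → (∀ y, |f y| ≤ C * Real.exp (ϑ * (pinnedChain ω₂ lam β γ).hamiltonian N y)) →
      |(∫ y, f y ∂((pinnedChain ω₂ lam β γ).transitionKernel N T T t z)) -
          ∫ y, f y ∂((pinnedChain ω₂ lam β γ).gibbsMeasure N T)| ≤
        K * C * Real.exp (ϑ * (pinnedChain ω₂ lam β γ).hamiltonian N z) * Real.exp (-c * t))
    (hc : 0 < c) {v : PhaseSpace N → ℝ} (hv : Continuous v) {Cv : ℝ} (hCv : 0 ≤ Cv)
    (hvb : ∀ y, |v y| ≤ Cv * Real.exp (ϑ * (pinnedChain ω₂ lam β γ).hamiltonian N y))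
    (ν : Measure (PhaseSpace N)) [IsFiniteMeasure ν]
    (hν : Integrable (fun y => Real.exp (2 * ϑ * (pinnedChain ω₂ lam β γ).hamiltonian N y)) ν)
    {F : PhaseSpace N → ℝ} (hFm : StronglyMeasurable F) (hF2 : Integrable (fun z => F z ^ 2) ν)
    {S : Set ℝ} {s : ℝ} (hexp : IntegrableOn (fun t : ℝ => Real.exp (-(s * t))) S) :
    ∫ z, F z * (∫ t in S, Real.exp (-(s * t)) *
        ∫ y, v y ∂((pinnedChain ω₂ lam β γ).transitionKernel N T T t.toNNReal z)) ∂ν =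
      ∫ t in S, Real.exp (-(s * t)) * ∫ z, F z *
        (∫ y, v y ∂((pinnedChain ω₂ lam β γ).transitionKernel N T T t.toNNReal z)) ∂ν := by
  set P := pinnedChain ω₂ lam β γ with hP
  set act : ℝ → PhaseSpace N → ℝ := fun t z => ∫ y, v y ∂(P.transitionKernel N T T t.toNNReal z) with hact
  set B : ℝ := |∫ y, v y ∂(P.gibbsMeasure N T)| + K * Cv with hB
  have hab : ∀ t z, |act t z| ≤ B * Real.exp (ϑ * P.hamiltonian N z) := fun t z =>
    pinnedChain_abs_act_le hω hl hβ hϑ0 hb hc hv hCv hvb z t.toNNReal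
  have hB0 : 0 ≤ B := by
    have := (abs_nonneg _).trans (hab 0 0)
    have hpos : 0 < Real.exp (ϑ * P.hamiltonian N (0 : PhaseSpace N)) := Real.exp_pos _
    nlinarith
  -- joint measurability of `(z, t) ↦ F z * (e^{-st} act t z)`
  have hjm : AEStronglyMeasurable (uncurry fun z t => F z * (Real.exp (-(s * t)) * act t z))
      (ν.prod (volume.restrict S)) := by
    have h1 := (pinnedChain_stronglyMeasurable_act_uncurry hω hl hβ.le hγ.le T T hv.measurable).comp_measurable
      (measurable_swap : Measurable fun q : PhaseSpace N × ℝ => q.swap)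
    have h2 : StronglyMeasurable fun q : PhaseSpace N × ℝ => F q.1 := hFm.comp_measurable measurable_fst
    have h3 : StronglyMeasurable fun q : PhaseSpace N × ℝ => Real.exp (-(s * q.2)) :=
      (Real.continuous_exp.comp (continuous_const.mul continuous_snd).neg).stronglyMeasurable
    exact (h2.mul (h3.mul h1)).aestronglyMeasurable
  -- the dominating product `(B (F² + e^{2ϑH})/2) ⊗ e^{-st}`
  have hwint : Integrable (fun z => B * ((F z ^ 2 + Real.exp (2 * ϑ * P.hamiltonian N z)) / 2)) ν :=
    ((hF2.add hν).div_const 2).const_mul B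
  have hprod : Integrable (uncurry fun z t => F z * (Real.exp (-(s * t)) * act t z)) (ν.prod (volume.restrict S)) := by
    refine Integrable.mono' (hwint.mul_prod hexp) hjm (Eventually.of_forall fun q => ?_)
    rcases q with ⟨z, t⟩
    simp only [uncurry]
    rw [norm_mul, norm_mul, Real.norm_eq_abs, Real.norm_eq_abs, Real.norm_eq_abs, abs_of_pos (Real.exp_pos _)]
    have h1 := hab t z
    have hE : Real.exp (ϑ * P.hamiltonian N z) ^ 2 = Real.exp (2 * ϑ * P.hamiltonian N z) := by
      rw [← Real.exp_nat_mul]; ring_nf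
    have hAM : |F z| * Real.exp (ϑ * P.hamiltonian N z) ≤ (F z ^ 2 + Real.exp (2 * ϑ * P.hamiltonian N z)) / 2 := by
      rw [← hE]
      nlinarith [sq_nonneg (|F z| - Real.exp (ϑ * P.hamiltonian N z)), sq_abs (F z)]
    calc |F z| * (Real.exp (-(s * t)) * |act t z|)
        ≤ |F z| * (Real.exp (-(s * t)) * (B * Real.exp (ϑ * P.hamiltonian N z))) := by gcongr
      _ = B * (|F z| * Real.exp (ϑ * P.hamiltonian N z)) * Real.exp (-(s * t)) := by ring
      _ ≤ B * ((F z ^ 2 + Real.exp (2 * ϑ * P.hamiltonian N z)) / 2) * Real.exp (-(s * t)) := by gcongr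
  have h1 : ∫ z, F z * (∫ t in S, Real.exp (-(s * t)) * act t z) ∂ν =
      ∫ z, (∫ t in S, F z * (Real.exp (-(s * t)) * act t z)) ∂ν := by
    refine integral_congr_ae (Eventually.of_forall fun z => ?_)
    dsimp only
    rw [integral_const_mul]
  rw [h1, integral_integral_swap hprod]
  refine integral_congr_ae (Eventually.of_forall fun t => ?_)
  dsimp only
  rw [← integral_const_mul]
  refine integral_congr_ae (Eventually.of_forall fun z => ?_)
  ring

/-! ### The shift identity for the resolvent -/

/-- **The shift identity**: for a nice `v`, `s > 0` and `h ≥ 0`,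
`P_h (R_s v)(z) = e^{sh} (R_s v(z) - ∫₀ʰ e^{-st} P_t v(z) dt)` — Fubini for `P_h(z,·) ⊗ dt`, the semigroup law
`P_h P_t = P_{h+t}`, the substitution `t ↦ t + h` and `∫_{(0,∞)} = ∫_{(0,h]} + ∫_{(h,∞)}`. This is the resolvent
equation `(1 - e^{-sh}P_h) R_s v = ∫₀ʰ e^{-st} P_t v dt` in a form that needs no generator. [folklore] -/
theorem pinnedChain_act_resolvent_eq {ϑ : ℝ} (hϑ0 : 0 < ϑ) (h2ϑ : 2 * ϑ < 1 / T)
    {v : PhaseSpace N → ℝ} (hv : Continuous v) {Cv : ℝ} (hCv : 0 ≤ Cv)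
    (hvb : ∀ y, |v y| ≤ Cv * Real.exp (ϑ * (pinnedChain ω₂ lam β γ).hamiltonian N y))
    {s : ℝ} (hs : 0 < s) (h : ℝ≥0) (z : PhaseSpace N) :
    ∫ y, (∫ t in Ioi (0 : ℝ), Real.exp (-(s * t)) *
        ∫ w, v w ∂((pinnedChain ω₂ lam β γ).transitionKernel N T T t.toNNReal y))
        ∂((pinnedChain ω₂ lam β γ).transitionKernel N T T h z) =
      Real.exp (s * h) * ((∫ t in Ioi (0 : ℝ), Real.exp (-(s * t)) *
          ∫ w, v w ∂((pinnedChain ω₂ lam β γ).transitionKernel N T T t.toNNReal z)) -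
        ∫ t in (0 : ℝ)..(h : ℝ), Real.exp (-(s * t)) *
          ∫ w, v w ∂((pinnedChain ω₂ lam β γ).transitionKernel N T T t.toNNReal z)) := by
  have hϑ1 : ϑ < 1 / T := by linarith
  have h2ϑ0 : 0 < 2 * ϑ := by positivity
  set P := pinnedChain ω₂ lam β γ with hP
  set κ := P.transitionKernel N T T with hκ
  haveI : ∀ u, IsMarkovKernel (κ u) := fun u => pinnedChain_isMarkovKernel_transitionKernel hω hl hβ.le hγ.le N T T u
  obtain ⟨K, c, -, hc, hb⟩ := pinnedChain_harris_bound hω hl hβ hγ hN hT hϑ0 hϑ1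
  set act : ℝ → PhaseSpace N → ℝ := fun t y => ∫ w, v w ∂(κ t.toNNReal y) with hact
  -- Step 1: Fubini for the probability measure `P_h(z, ·)`
  have hν : Integrable (fun y => Real.exp (2 * ϑ * P.hamiltonian N y)) (κ h z) :=
    pinnedChain_integrable_exp_mul_hamiltonian_transitionKernel hω hl hT hβ.le hγ.le hN h2ϑ0 h2ϑ h z
  have hexp : IntegrableOn (fun t : ℝ => Real.exp (-(s * t))) (Ioi 0) := by
    have := exp_neg_integrableOn_Ioi 0 hs
    refine this.congr (Eventually.of_forall fun t => ?_); simp [neg_mul]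
  have hone2 : Integrable (fun _ : PhaseSpace N => (1 : ℝ) ^ 2) (κ h z) := integrable_const _
  have h1 := pinnedChain_integral_mul_setIntegral_exp_act hω hl hβ hγ hϑ0 hb hc hv hCv hvb (κ h z) hν
    stronglyMeasurable_const hone2 hexp
  simp only [one_mul] at h1
  rw [h1]
  -- Step 2: the semigroup law `∫ act t dP_h(z,·) = act (t + h) z` for `t > 0`
  have h2 : ∀ t ∈ Ioi (0 : ℝ), Real.exp (-(s * t)) * ∫ y, act t y ∂(κ h z) =
      Real.exp (s * h) * (Real.exp (-(s * (t + h))) * act (t + h) z) := by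
    intro t ht
    have ht0 : 0 ≤ t := le_of_lt ht
    have hsg : (t + h).toNNReal = h + t.toNNReal := by
      rw [Real.toNNReal_add ht0 h.coe_nonneg, Real.toNNReal_coe, add_comm]
    simp only [hact]
    rw [pinnedChain_act_act_eq_nice hω hl hN hT hβ.le hγ.le hϑ0 hϑ1 hv hvb, hsg,
      show Real.exp (s * h) * (Real.exp (-(s * (t + h))) * ∫ w, v w ∂(κ (h + t.toNNReal) z)) =
        (Real.exp (s * h) * Real.exp (-(s * (t + h)))) * ∫ w, v w ∂(κ (h + t.toNNReal) z) by ring,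
      ← Real.exp_add]
    congr 1
    congr 1
    ring
  rw [setIntegral_congr_fun measurableSet_Ioi h2, integral_const_mul,
    setIntegral_Ioi_comp_add_right (fun t => Real.exp (-(s * t)) * act t z) h]
  -- Step 3: `∫_{(h,∞)} = ∫_{(0,∞)} - ∫₀ʰ`
  have hI0 : IntegrableOn (fun t => Real.exp (-(s * t)) * act t z) (Ioi 0) :=
    pinnedChain_integrableOn_resolvent hω hl hβ hγ hϑ0 hb hc hv hCv hvb hs z
  have hIh : IntegrableOn (fun t => Real.exp (-(s * t)) * act t z) (Ioi (h : ℝ)) :=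
    hI0.mono_set (Ioi_subset_Ioi h.coe_nonneg)
  have hsplit := intervalIntegral.integral_interval_add_Ioi hI0 hIh
  rw [← hsplit]
  ring

end Pinned

end Summit.AtomisticToContinuum.FouriersLaw.Theorems.HonestZwanzig

end
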